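import Mathlib
import Summits.Ventures.HodgeRepro.Tier4.Line4.FoldedUnfolded
import Summits.Ventures.HodgeRepro.Tier4.Line4.RatioReduce

/-!
# Tier4/Line4/CompactCutFold — C-L4-COMPACT-CUT (F-a)+(F-b): the folded support measure through the COMPACT cut of the
unfolded one, and the fibre bound on that cut

Blind re-derivation cell `pub-hodge-repro`, Tier 4 «prove the step» (README §9–§10), seat t4-L1-p4 (gen 5; LINE L4;
STATUS S15641 (3) (F-a)/(F-b) after crit-2 g9's Entry 314 (S15609) asked for the FOLD step of the display (F) and
t4-L2-p3's finding F-L4-PROJ-NONUNIFORM (S15509) killed the route through the unfolded measure at `γ`).  Tree path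
`lean/Summits/Ventures/HodgeRepro/Tier4/Line4/CompactCutFold.lean`.  Imports `Line4/FoldedUnfolded` (t4-x2, p707234:
`levelSuppSet_eq_preimage`, `prod_apply_preimage_finPair`) and `Line4/RatioReduce` (t4-L2-p1, p707820: `fibreSet`,
`projSet`, `measure_fibreSet_le`; through it `Line4/SuppMeasure` and `Line4/LevelTailInstance`).  Mathlib-level; no
literature; no `def`.

WHY THE COMPACT CUT.  The display (F) of record (S15514) bounds the FOLDED measure
`suppMeasureFolded N γ = (μ_T ⊗ μ_{T′})({(t, t′) ∈ D_T × D_{T′} : (t⁻¹ γ t′)_f ∈ K(N) γ₀,f K(N)})` by a constant times the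
unit `suppMeasure N γ₀`.  The UNFOLDED measure at `γ` — `(ν_f ⊗ ν′_f)(suppSet γ ∩ (DZ_f × T′_f))`, the `Z(k)`-fundamental-
domain cut — is NOT uniformly comparable to the unit over rational `γ` (F-L4-PROJ-NONUNIFORM: near a local transporter at
a place `v ∤ p` the `T_f`-projection of the support set has unbounded measure modulo `Δ(Z_f)`), so the FOLD must land on
the COMPACT cut `Ψ_{C,C′}(γ) := (ν_f ⊗ ν′_f)(suppSet γ ∩ (C × C′))` with `C ⊇ π_f(D_T)`, `C′ ⊇ π_f(D_{T′})` compact, where the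
free direction is cut to a bounded piece.

* `measure_inter_prod_univ_eq_lintegral` — Fubini for a cut of the product measure along a measurable `A ⊆ T_f`:
  `(ν_f ⊗ ν′_f)(S ∩ (A × T′_f)) = ∫⁻_{c ∈ A} ν′_f(S_c) dν_f` (the general form of RatioReduce's `suppMeasure_eq_lintegral_fibre`).
* `suppSetFolded_subset_preimage_compactCut` — `A_N γ ⊆ {(t, t′) : (t_f, t′_f) ∈ suppSet γ ∩ (C × C′)}` once `C ⊇ π_f(D_T)`,
  `C′ ⊇ π_f(D_{T′})`.
* **`suppMeasureFolded_le_mul_compactCut` (F-a)** — `suppMeasureFolded N γ ≤ c c′ ν_∞(T_∞) ν′_∞(T′_∞) · Ψ_{C,C′}(γ)` for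
  measurable `C`, `C′` as above (x2's `prod_apply_preimage_finPair` on the preimage; no `Z(k)`-tiling).
* **`measure_compactCut_le_card_mul` (F-b)** — `Ψ_{C,C′}(γ) ≤ reps.card · ν′_f(levelTf′ N) · ν_f(C ∩ projSet γ)` from the
  fibre bound `measure_fibreSet_le` (every fibre is at most `reps.card` cosets of `T′_f ∩ K(N)`).
* **`suppMeasureFolded_le_card_mul_projSet`** — the two composed, at the canonical compact cut
  `C = π_f(closure D_T)`, `C′ = π_f(closure D_{T′})` (`compT`, `compT′` = TailGlue's binders):
  `suppMeasureFolded N γ ≤ c c′ ν_∞(T_∞) ν′_∞(T′_∞) · reps.card · ν′_f(levelTf′ N) · ν_f(π_f(closure D_T) ∩ projSet γ)`.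
  What (F) still needs after this is the PROJECTION bound on the compact cut, uniform in `γ`:
  `ν_f(π_f(closure D_T) ∩ projSet γ) ≤ M · ν_f(DZ_f ∩ Z_f · levelTf N)`-type — P2 (the `p`-adic congruence), P1 (the split of
  `ν_f` at `p`), P3 (the level-box index) and the central covering lemma (S15641 (3) (F-c)/(F-d)); `reps.card` is bounded
  along `p^n` by (S-IDX) (LevelIndexBound / LevelIndexCount).

Nothing here says anything about the status of the Hodge conjecture for CM abelian varieties, which is NOT proved
(HC_CM is NOT proved by anyone in this repository).
-/

set_option autoImplicit false
noncomputable section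
namespace Summit.Ventures.HodgeRepro.Tier4.Line4
open Summit.Ventures.HodgeRepro.Tier4 Summit.Ventures.HodgeRepro.Tier4.Common
  Summit.Ventures.HodgeRepro.Tier4.Line1 MeasureTheory
open scoped ENNReal NNReal Pointwise

section Fubini
variable {k : Type} [Field k] [NumberField k] (W : PlaneData k) [MeasurableSpace (GA W)]
  (νf : Measure (torusFin W)) (νf' : Measure (torusFin' W))

/-- **Fubini for a cut of the product measure along `T_f`**: for measurable `A ⊆ T_f` and `S ⊆ T_f × T′_f`,
`(ν_f ⊗ ν′_f)(S ∩ (A × T′_f)) = ∫⁻_{c ∈ A} ν′_f(S_c) dν_f`, `S_c = Prod.mk c ⁻¹' S` the slice. -/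
theorem measure_inter_prod_univ_eq_lintegral [νf'.IsHaarMeasure] {A : Set (torusFin W)} (hA : MeasurableSet A)
    {S : Set (torusFin W × torusFin' W)} (hS : MeasurableSet S) :
    (νf.prod νf') (S ∩ A ×ˢ Set.univ) = ∫⁻ c in A, νf' (Prod.mk c ⁻¹' S) ∂νf := by
  haveI : LocallyCompactSpace (torusFin' W) := locallyCompact_torusFin' W
  haveI : SecondCountableTopology (torusFin' W) := secondCountable_torusFin' W
  haveI : IsLocallyFiniteMeasure νf' := isLocallyFiniteMeasure_of_isFiniteMeasureOnCompacts
  haveI : SigmaFinite νf' := sigmaFinite_of_locallyFinite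
  have hmeas : MeasurableSet (S ∩ A ×ˢ Set.univ) := hS.inter (hA.prod MeasurableSet.univ)
  rw [Measure.prod_apply hmeas, ← lintegral_indicator hA]
  refine lintegral_congr fun c => ?_
  by_cases hc : c ∈ A
  · rw [Set.indicator_of_mem hc]
    congr 1
    ext c'
    simp [hc]
  · rw [Set.indicator_of_notMem hc]
    have : Prod.mk c ⁻¹' (S ∩ A ×ˢ Set.univ) = ∅ := by
      ext c'
      simp [hc]
    rw [this, measure_empty]

end Fubini

section Fold
variable {k : Type} [Field k] [NumberField k] (W : PlaneData k) [MeasurableSpace (GA W)] (R : RTFData W)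

/-- **The folded support set lies over the compact cut**: if `C ⊇ π_f(D_T)` and `C′ ⊇ π_f(D_{T′})`, then
`A_N γ ⊆ {(t, t′) : (t_f, t′_f) ∈ suppSet γ ∩ (C × C′)}`. -/
theorem suppSetFolded_subset_preimage_compactCut (γ₀ : GA W) (N : ℕ) (γ : GA W) {C : Set (torusFin W)}
    {C' : Set (torusFin' W)} (hC : ∀ t ∈ R.DT, finTf W t ∈ C) (hC' : ∀ t' ∈ R.DT', finTf' W t' ∈ C') :
    suppSetFolded W R γ₀ N γ ⊆ Prod.map (finTf W) (finTf' W) ⁻¹' (suppSet W γ₀ N γ ∩ C ×ˢ C') := by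
  intro p hp
  rw [suppSetFolded_eq_inter, levelSuppSet_eq_preimage] at hp
  obtain ⟨hp1, hp2, hp3⟩ := hp
  exact ⟨hp1, hC p.1 hp2, hC' p.2 hp3⟩

/-- **(F-a) THE COMPACT-CUT FOLD**: `suppMeasureFolded N γ ≤ c c′ ν_∞(T_∞) ν′_∞(T′_∞) · (ν_f ⊗ ν′_f)(suppSet γ ∩ (C × C′))`
for measurable `C ⊇ π_f(D_T)`, `C′ ⊇ π_f(D_{T′})`; binders `hR`, `hc`, `hc′` = the chain's Haar normalisations. -/
theorem suppMeasureFolded_le_mul_compactCut [BorelSpace (GA W)] (hR : R.IsHaar)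
    (νinf : Measure (torusInf W)) [νinf.IsHaarMeasure] (νf : Measure (torusFin W)) [νf.IsHaarMeasure]
    (c : ℝ≥0) (hc : R.μT = c • Measure.map (torusSplit W).symm (νinf.prod νf))
    (νinf' : Measure (torusInf' W)) [νinf'.IsHaarMeasure] (νf' : Measure (torusFin' W)) [νf'.IsHaarMeasure]
    (c' : ℝ≥0) (hc' : R.μT' = c' • Measure.map (torusSplit' W).symm (νinf'.prod νf'))
    (γ₀ : GA W) {N : ℕ} (hN : N ≠ 0) (γ : GA W) {C : Set (torusFin W)} {C' : Set (torusFin' W)}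
    (hCm : MeasurableSet C) (hC'm : MeasurableSet C')
    (hC : ∀ t ∈ R.DT, finTf W t ∈ C) (hC' : ∀ t' ∈ R.DT', finTf' W t' ∈ C') :
    suppMeasureFolded W R γ₀ N γ ≤
      ((c : ℝ≥0∞) * νinf Set.univ * ((c' : ℝ≥0∞) * νinf' Set.univ)) *
        (νf.prod νf') (suppSet W γ₀ N γ ∩ C ×ˢ C') := by
  haveI : BorelSpace (torusFin W) := Subtype.borelSpace _
  haveI : BorelSpace (torusFin' W) := Subtype.borelSpace _
  have hS : MeasurableSet (suppSet W γ₀ N γ ∩ C ×ˢ C') := (measurableSet_suppSet W γ₀ hN γ).inter (hCm.prod hC'm)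
  calc suppMeasureFolded W R γ₀ N γ
      ≤ (R.μT.prod R.μT') (Prod.map (finTf W) (finTf' W) ⁻¹' (suppSet W γ₀ N γ ∩ C ×ˢ C')) :=
        measure_mono (suppSetFolded_subset_preimage_compactCut W R γ₀ N γ hC hC')
    _ = _ := prod_apply_preimage_finPair W R hR νinf νf c hc νinf' νf' c' hc' hS

end Fold

section FibreBound
variable {k : Type} [Field k] [NumberField k] (W : PlaneData k) [MeasurableSpace (GA W)] [BorelSpace (GA W)]
  (νf : Measure (torusFin W)) (νf' : Measure (torusFin' W)) (γ₀ : GA W) (N : ℕ) (γ : GA W)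

/-- **(F-b) THE FIBRE BOUND ON THE COMPACT CUT**: `(ν_f ⊗ ν′_f)(suppSet γ ∩ (C × C′)) ≤ reps.card · ν′_f(levelTf′ N) ·
ν_f(C ∩ projSet γ)` whenever the double coset is covered by the `reps.card` left cosets `g K(N)`, `g ∈ reps`
(`measure_fibreSet_le`: every fibre is at most `reps.card` cosets of `T′_f ∩ K(N)`; the outer measure of the projection). -/
theorem measure_compactCut_le_card_mul [νf.IsHaarMeasure] [νf'.IsHaarMeasure] (hN : N ≠ 0)
    {C : Set (torusFin W)} {C' : Set (torusFin' W)} (hCm : MeasurableSet C) (reps : Finset (GA W))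
    (hcov : levelDoubleCoset W N (GA.ofFinPart W γ₀) ⊆ ⋃ g ∈ reps, g • (levelK W N : Set (GA W))) :
    (νf.prod νf') (suppSet W γ₀ N γ ∩ C ×ˢ C') ≤
      reps.card * νf' (levelTf' W N) * νf (C ∩ projSet W γ₀ N γ) := by
  have hpt : ∀ b ∈ C, νf' (fibreSet W γ₀ N γ b) ≤
      (C ∩ projSet W γ₀ N γ).indicator (fun _ => (reps.card : ℝ≥0∞) * νf' (levelTf' W N)) b := by
    intro b hb
    by_cases hp : b ∈ projSet W γ₀ N γ
    · rw [Set.indicator_of_mem (show b ∈ C ∩ projSet W γ₀ N γ from ⟨hb, hp⟩)]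
      exact measure_fibreSet_le W νf' γ₀ N γ reps hcov b
    · rw [Set.indicator_of_notMem (fun h => hp h.2)]
      have : fibreSet W γ₀ N γ b = ∅ := Set.not_nonempty_iff_eq_empty.1 hp
      rw [this, measure_empty]
  calc (νf.prod νf') (suppSet W γ₀ N γ ∩ C ×ˢ C')
      ≤ (νf.prod νf') (suppSet W γ₀ N γ ∩ C ×ˢ Set.univ) :=
        measure_mono (Set.inter_subset_inter_right _ (Set.prod_mono subset_rfl (Set.subset_univ _)))
    _ = ∫⁻ b in C, νf' (fibreSet W γ₀ N γ b) ∂νf :=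
        measure_inter_prod_univ_eq_lintegral W νf νf' hCm (measurableSet_suppSet W γ₀ hN γ)
    _ ≤ ∫⁻ b in C, (C ∩ projSet W γ₀ N γ).indicator (fun _ => (reps.card : ℝ≥0∞) * νf' (levelTf' W N)) b ∂νf :=
        setLIntegral_mono' hCm hpt
    _ ≤ ∫⁻ b, (C ∩ projSet W γ₀ N γ).indicator (fun _ => (reps.card : ℝ≥0∞) * νf' (levelTf' W N)) b ∂νf :=
        setLIntegral_le_lintegral _ _
    _ ≤ (reps.card : ℝ≥0∞) * νf' (levelTf' W N) * νf (C ∩ projSet W γ₀ N γ) :=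
        lintegral_indicator_const_le _ _

end FibreBound

section Composed
variable {k : Type} [Field k] [NumberField k] (W : PlaneData k) [MeasurableSpace (GA W)] [BorelSpace (GA W)]
  (R : RTFData W)

omit [BorelSpace (GA W)] in
/-- The finite-part image of the closure of `D_T` is compact (`compT`, `continuous_finTf`). -/
theorem isCompact_finTf_image_closure_DT (compT : IsCompact (closure R.DT)) :
    IsCompact (finTf W '' closure R.DT) :=
  compT.image (continuous_finTf W)

omit [BorelSpace (GA W)] in
/-- The finite-part image of the closure of `D_{T′}` is compact. -/
theorem isCompact_finTf'_image_closure_DT' (compT' : IsCompact (closure R.DT')) :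
    IsCompact (finTf' W '' closure R.DT') :=
  compT'.image (continuous_finTf' W)

/-- **(F-a)+(F-b) AT THE CANONICAL COMPACT CUT** `C = π_f(closure D_T)`, `C′ = π_f(closure D_{T′})`:
`suppMeasureFolded N γ ≤ c c′ ν_∞(T_∞) ν′_∞(T′_∞) · (reps.card · ν′_f(levelTf′ N) · ν_f(π_f(closure D_T) ∩ projSet γ))`;
binders = TailGlue's `compT`, `compT′`, the chain's `hR hc hc′`, and a cover `reps` of the double coset. -/
theorem suppMeasureFolded_le_card_mul_projSet (hR : R.IsHaar)
    (compT : IsCompact (closure R.DT)) (compT' : IsCompact (closure R.DT'))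
    (νinf : Measure (torusInf W)) [νinf.IsHaarMeasure] (νf : Measure (torusFin W)) [νf.IsHaarMeasure]
    (c : ℝ≥0) (hc : R.μT = c • Measure.map (torusSplit W).symm (νinf.prod νf))
    (νinf' : Measure (torusInf' W)) [νinf'.IsHaarMeasure] (νf' : Measure (torusFin' W)) [νf'.IsHaarMeasure]
    (c' : ℝ≥0) (hc' : R.μT' = c' • Measure.map (torusSplit' W).symm (νinf'.prod νf'))
    (γ₀ : GA W) {N : ℕ} (hN : N ≠ 0) (γ : GA W) (reps : Finset (GA W))
    (hcov : levelDoubleCoset W N (GA.ofFinPart W γ₀) ⊆ ⋃ g ∈ reps, g • (levelK W N : Set (GA W))) :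
    suppMeasureFolded W R γ₀ N γ ≤
      ((c : ℝ≥0∞) * νinf Set.univ * ((c' : ℝ≥0∞) * νinf' Set.univ)) *
        (reps.card * νf' (levelTf' W N) * νf (finTf W '' closure R.DT ∩ projSet W γ₀ N γ)) := by
  haveI : T2Space (GA W) := t2Space_GA W
  haveI : BorelSpace (torusFin W) := Subtype.borelSpace _
  haveI : BorelSpace (torusFin' W) := Subtype.borelSpace _
  have hCm : MeasurableSet (finTf W '' closure R.DT) :=
    (isCompact_finTf_image_closure_DT W R compT).isClosed.measurableSet
  have hC'm : MeasurableSet (finTf' W '' closure R.DT') :=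
    (isCompact_finTf'_image_closure_DT' W R compT').isClosed.measurableSet
  calc suppMeasureFolded W R γ₀ N γ
      ≤ ((c : ℝ≥0∞) * νinf Set.univ * ((c' : ℝ≥0∞) * νinf' Set.univ)) *
          (νf.prod νf') (suppSet W γ₀ N γ ∩ (finTf W '' closure R.DT) ×ˢ (finTf' W '' closure R.DT')) :=
        suppMeasureFolded_le_mul_compactCut W R hR νinf νf c hc νinf' νf' c' hc' γ₀ hN γ hCm hC'm
          (fun t ht => ⟨t, subset_closure ht, rfl⟩) (fun t' ht' => ⟨t', subset_closure ht', rfl⟩)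
    _ ≤ _ :=
        mul_le_mul_right (measure_compactCut_le_card_mul W νf νf' γ₀ N γ hN hCm reps hcov) _

end Composed

end Summit.Ventures.HodgeRepro.Tier4.Line4

end
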